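import Literature.AlgebraicGeometry.Frobenioids.ModelFrobenioidComparison
import Literature.AlgebraicGeometry.Frobenioids.IsometricPreStepsPullback
import Literature.AlgebraicGeometry.Frobenioids.BiratGerms
import HarnessLib

/-!
# Frobenioids I, Proposition 2.2 (ii)(a) for `C^birat`: transport of `O^×(A^birat)` along pull-back
morphisms (existence)

Mochizuki, *The geometry of Frobenioids I: the general theory*, Kyushu J. Math. **62** (2008)
293–400, §2 Proposition 2.2 (ii)(a) p. 45 ("if `φ` is a [co-angular] linear morphism, then
`O^▷(φ_{D*}) : O^▷(B) → O^▷(A)` is the inclusion of Proposition 1.11, (iv)"), §1 Proposition 1.11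
(iv)/(v) pp. 36–37, and §4 Proposition 4.4 (iv) p. 83 ("pull-back morphism … co-angular linear
morphism" of `C` ↦ pull-back morphism of `C^birat`) [cite: MochizukiFrdI2008, Prop. 2.2(ii) p.45].

For the rational function monoid `A ↦ O^×(A^birat)` to be a functor on `D` (the hypothesis
`RationalFunctionMonoidStr.natural` of the Thm. 5.2 (iv) statement,
`ModelFrobenioidComparison.lean`),
a unit `v ∈ O^×(A'^birat)` must transport along a pull-back morphism `ψ : A → A'` to a `u ∈
O^×(A^birat)`
with "`ψ ∘ u = v ∘ ψ` in `C^birat`" (`BiratUnits.Intertwines`).  This file proves the EXISTENCE of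
such a `u` for a Frobenioid of isotropic type: pull the denominator `β` of `v = [(β, χ)]` back along
`ψ` — a square `α ≫ ψ = λ₀ ≫ β` with `α` a co-angular pre-step and `λ₀` a pull-back morphism, from
Def. 1.3 (i)(c) (`exists_isPullbackMorphism_over`, seat abc-iut-L1-t1) and the universal property
of the
pull-back morphism `ψ` (`IsPullbackMorphism.exists_lift`) — and lift `λ₀ ≫ χ` through `ψ` the same
way.
Uniqueness of `u` and the homomorphism property (Prop. 1.11 (iv) for `C^birat`) are the next file.
(Requires the v2 `Intertwines`, whose right leg is an arbitrary morphism — here the pull-back `λ₀`.)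
-/

namespace Literature.AlgebraicGeometry.Frobenioids

open CategoryTheory Opposite

universe w v v' u u'

namespace PreFrobenioid

variable {D : Type u} [Category.{v} D] {Φ : Dᵒᵖ ⥤ CommMonCat.{w}}
  {C : Type u'} [Category.{v'} C] {F : C ⥤ ElemFrobenioid Φ}

/-- **Pulling a co-angular pre-step back along a pull-back morphism** (Prop. 1.11 (v), special
case, via
Def. 1.3 (i)(c)): for a pull-back morphism `ψ : A → A'` and a co-angular pre-step `β : B' → A'` of a
Frobenioid of isotropic type there are a co-angular pre-step `α : W → A` and a pull-back morphism
`λ₀ : W → B'` with `α ≫ ψ = λ₀ ≫ β`. [cite: MochizukiFrdI2008, Prop. 1.11(v) p.37] -/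
theorem exists_preStep_pullback_square (hF : IsFrobenioid F) (hiso : IsOfIsotropicType F)
    {A A' B' : C}
    (ψ : A ⟶ A') (hψ : IsPullbackMorphism F ψ) (β : B' ⟶ A') (hβ : IsCoAngularPreStep F β) :
    ∃ (W : C) (α : W ⟶ A) (l : W ⟶ B'), IsCoAngularPreStep F α ∧ IsPullbackMorphism F l ∧
      α ≫ ψ = l ≫ β := by
  haveI : IsIso (Base F β) := hβ.2.2
  -- pull the "line bundle" `β` back along `Base ψ ≫ Base(β)⁻¹`
  obtain ⟨W, l, i, hl, hlbase⟩ :=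
    exists_isPullbackMorphism_over hF B' (Base F ψ ≫ inv (Base F β))
  -- lift `l ≫ β` through the pull-back morphism `ψ`
  have hb : Base F (l ≫ β) = i.hom ≫ Base F ψ := by
    rw [base_comp, hlbase, Category.assoc, Category.assoc, IsIso.inv_hom_id, Category.comp_id]
  obtain ⟨α, hαψ, hαbase⟩ := hψ.exists_lift (l ≫ β) i.hom hb
  have hlin : IsLinear F α := by
    have h := congrArg (degFr F) hαψ
    rw [degFr_comp, degFr_comp, (hF.iv_b ψ hψ).2, (hF.iv_b l hl).2, hβ.2.1, mul_one] at h
    exact h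
  have hbi : IsBaseIso F α := by
    change IsIso (Base F α)
    rw [hαbase]
    infer_instance
  exact ⟨W, α, l, isCoAngularPreStep_of_isotropic hiso ⟨hlin, hbi⟩, hl, hαψ⟩

namespace BiratUnits

variable {hF : IsFrobenioid F}

variable (hF) in
/-- **Prop. 2.2 (ii)(a) / 1.11 (iv) for `C^birat`, existence**: along a pull-back morphism `ψ : A →
A'`
of a Frobenioid of isotropic type, every rational function `v ∈ O^×(A'^birat)` is intertwined with
some `u ∈ O^×(A^birat)`: "`ψ ∘ u = v ∘ ψ` in `C^birat`".  (`u` is the value `B(Base ψ)(v)` of the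
rational function monoid.) [cite: MochizukiFrdI2008, Prop. 2.2(ii) p.45] -/
theorem exists_intertwines_of_isPullbackMorphism (hiso : IsOfIsotropicType F) {A A' : C}
    (ψ : A ⟶ A') (hψ : IsPullbackMorphism F ψ) (v : BiratUnits F hF A') :
    ∃ u : BiratUnits F hF A, Intertwines hF ψ u v := by
  obtain ⟨q, rfl⟩ := mk_surjective v
  haveI : IsIso (Base F q.den) := q.den_mem.2.2
  obtain ⟨W, α, l, hα, hl, hsq⟩ := exists_preStep_pullback_square hF hiso ψ hψ q.den q.den_mem
  -- lift `l ≫ χ` through `ψ` over `Base α`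
  have hb : Base F (l ≫ q.num) = Base F α ≫ Base F ψ := by
    rw [base_comp, ← q.baseEq, ← base_comp, ← hsq, base_comp]
  obtain ⟨φ, hφψ, hφbase⟩ := hψ.exists_lift (l ≫ q.num) (Base F α) hb
  have hlin : IsLinear F φ := by
    have h := congrArg (degFr F) hφψ
    rw [degFr_comp, degFr_comp, (hF.iv_b ψ hψ).2, (hF.iv_b l hl).2, q.num_mem.2.1, mul_one] at h
    exact h
  have hbi : IsBaseIso F φ := by
    change IsIso (Base F φ)
    rw [hφbase]
    exact hα.2.2
  let p : RatFrac F A := ⟨W, α, φ, hα, isCoAngularPreStep_of_isotropic hiso ⟨hlin, hbi⟩,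
    hφbase.symm⟩
  refine ⟨mk hF p, p, q, W, 𝟙 W, l, rfl, rfl, isCoAngularPreStep_id hF W, ?_, ?_⟩
  · change l ≫ q.den = 𝟙 W ≫ α ≫ ψ
    rw [Category.id_comp, hsq]
  · change l ≫ q.num = 𝟙 W ≫ φ ≫ ψ
    rw [Category.id_comp, hφψ]

end BiratUnits

end PreFrobenioid

end Literature.AlgebraicGeometry.Frobenioids
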